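import Literature.AlgebraicGeometry.Resolution.BlowupChartSNCLocal
import Literature.AlgebraicGeometry.Resolution.BlowupChartRsop
import Mathlib.Algebra.MvPolynomial.PDeriv
import Mathlib.Algebra.CharP.Invertible
import HarnessLib

/-!
# A unit monomial in the free chart generators is not a `p`-th power modulo `𝔪² +` (exceptional and boundary coordinates)

Topic: `Literature/AlgebraicGeometry/Resolution`. The "REG clause at the new regular-type
points" of a blow-up chart, in the ring-level chart settings of `BlowupChartSNCLocal.lean`
(the chart `B = (R[It])_{(x_i t)}` of the blowing up of `I = (x_1, …, x_r)` in a ring `R`, a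
prime `Q ⊂ B` over a prime `𝔭 ⊂ R`, `S = B_Q` the local ring of the blow-up at a point of the
exceptional divisor — the setting of `exists_rsop_chart`, which is what `BlowupSNC.ChartData`
feeds with `S = 𝒪_{X',x'}`) and of `BlowupChartRsop.lean` (`R` itself regular local with
regular system of parameters `(c, w)`, the chart `chartRing c i` at a prime over `𝔪_R` — the
setting of `isRsopPart_chartFamily_reesChart` and of `IsBlowup.exists_reesChart_stalk`).

**Theorem** (`reesChart_unit_mul_prod_chartGen_pow_sub_pow_notMem_span`; structure maps
`φ : R → B`, `B → S` suppressed). Let `x` be quasi-regular in `R`, `φ(x_i) ∈ Q`,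
`φ(s) ∈ Q ↔ s ∈ 𝔭`. Suppose all the chart generators `e_j = x_j/x_i`, `j ≠ i`, are units at
the point (`e_j ∉ Q`), `s ∈ R ∖ 𝔭` (a unit downstairs), `a : Fin r → ℕ` with `p ∤ a_{j₀}` for
some `j₀ ≠ i`, `p` a prime lying in the maximal ideal of `S` (e.g. `char S = p`), and
`w_m ∈ 𝔭` for `m ∈ Lab` (the boundary coordinates). Then for every `δ ∈ S`

  `s · ∏_j e_j^{a_j} − δ^p ∉ 𝔪_S² + (x_i, (w_m)_{m ∈ Lab}) S`

(`e_i = 1`, so the factor `j = i` is `1`; the product is taken in `S`). Variants: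
`…_notMem` (boundary equations as any ideal `K ⊆ 𝔭`, conclusion modulo the stage ideal
`J(K, ∅) S` of `BlowupChartQuotients.lean`), `…_span_of_isUnit` (the unit factor is
`ψ_A(u)` for a unit `u` of `A = R_𝔭` and a map `ψ_A : A → S` with `ψ_A(t/1) = φ(t)`, e.g.
the stalk map), `unit_mul_prod_chartGen_pow_sub_pow_notMem_span` (`R` regular local,
`𝔭 = 𝔪_R`, `(x, w) = (c, w)` a regular system of parameters, `s ∈ Rˣ`). In words: at a point
of the blow-up over the centre at which no new coordinate is charged, the unit radicand
`s ∏ e_j^{a_j}` is not congruent to a `p`-th power modulo the square of the maximal ideal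
and the parameters cutting out the exceptional divisor and the old boundary components through
the point — adjoining its `p`-th root keeps the local ring regular, transversally to the
boundary.

Proof. Pass to `S̄ = S/(x_i, w_Lab)S`, the localization at the prime `𝔔₀(Q)` of the
polynomial ring `(R/(I + (w_Lab)))[T_j : j ≠ i]` (`chartStageEquiv`, `chartStageAlgebra`,
`isLocalization_atPrime_chartStage`), in which `s ∏ e_j^{a_j}` becomes `s̄ ∏ T_j^{a_j}`;
`𝔔₀(Q)` contains `p` and no variable, and `s̄ ∉ 𝔔₀(Q)`. The derivation `D = ∂/∂T_{j₀}` maps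
`𝔔₀²` into `𝔔₀` (Leibniz) and `p`-th powers into `(p) ⊆ 𝔔₀`, while
`T_{j₀} · D(s̄ ∏ T^a) = a_{j₀} · s̄ ∏ T^a ∉ 𝔔₀` (Euler; `a_{j₀}` is a unit modulo `𝔔₀` as
`p ∈ 𝔔₀`, `p ∤ a_{j₀}`). If `s̄ ∏ T^a − δ̄^p ∈ 𝔪_{S̄}² = 𝔔₀² S̄`, clearing denominators
gives `m (g^p s̄ ∏ T^a − f^p) ∈ 𝔔₀²` with `m, g ∉ 𝔔₀`, and applying `D` yields
`g^p D(s̄ ∏ T^a) ∈ 𝔔₀`, a contradiction (`sub_pow_notMem_maximalIdeal_sq_sup_of_leibniz`,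
stated for any additive operator with the Leibniz rule on any ring). Finally `S → S̄` maps
`𝔪_S² + (x_i, w_Lab)S` into `𝔪_{S̄}²`.

Contents (all PROVED, [folklore]):

* `sub_pow_notMem_maximalIdeal_sq_sup_of_leibniz` — the derivation argument, abstractly;
* `natCast_notMem_of_not_dvd`, `pderiv_C_mul_prod_X_pow_notMem` — Euler's identity for the unit
  monomial; `C_mul_prod_X_pow_sub_pow_notMem_maximalIdeal_sq` — the statement for a
  localization of a polynomial ring at a prime containing `p` and no variable;
* `reesChart_unit_mul_prod_chartGen_pow_sub_pow_notMem`, `…_span`, `…_span_of_isUnit` — the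
  chart of a ring `R` at a prime `Q` over `𝔭`;
* `unit_mul_prod_chartGen_pow_sub_pow_notMem_span` — the chart of a regular local ring along
  part of a regular system of parameters.

What is NOT here: the scheme-level statement (the consumer instantiates `S` with a stalk
`𝒪_{X',x'}` through `BlowupSNC.ChartData.algB`/`isLocalization_B`/`algebraMap_reesChartBase`
or through `IsBlowup.exists_reesChart_stalk`), and the converse direction of the regularity
criterion for `S[y]/(y^p − f)`.

## Sources

* J. Kollár, *Lectures on Resolution of Singularities* (2007), Def. 3.24–3.25 (the chart
  description of the blow-up along a stratum of a simple normal crossings divisor). [Kollar2007]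
* The Stacks Project, Tag 0BIQ (the chart `R[I/x_i] ≅ R[T]/(x_i T_j − x_j)` of the blowing up
  of a regular sequence). [StacksProject]
* V. Cossart, O. Piltant, *Resolution of singularities of threefolds in positive
  characteristic I*, J. Algebra 320 (2008) (regularity of purely inseparable coverings
  `y^p = f` read off from `f` modulo `p`-th powers and `𝔪²`). [CossartPiltant2008]
-/

noncomputable section

open IsLocalRing MvPolynomial HomogeneousLocalization

namespace Literature.AlgebraicGeometry.Resolution

universe u

/-! ## The derivation argument -/

section Derivation

/-- **An operator with the Leibniz rule detects non-`p`-th powers modulo `𝔪²`.** Let `P` be a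
prime of `T`, `L = T_P`, `𝔟 ⊆ P` an ideal, and `D : T → T` additive with
`D(xy) = x Dy + y Dx`, `D(x^p) ∈ P` for all `x` (e.g. a derivation, `p ∈ P`) and `D(𝔟) ⊆ P`.
If `D t ∉ P`, then `t − δ^p ∉ 𝔪_L² + 𝔟 L` for every `δ ∈ L`: clearing denominators,
`m (g^p t − f^p) ∈ P² + 𝔟` with `m, g ∉ P`, and `D` maps `P² + 𝔟` into `P`, whence
`g^p · D t ∈ P`. [folklore] -/
theorem sub_pow_notMem_maximalIdeal_sq_sup_of_leibniz {T : Type*} [CommRing T] (P : Ideal T)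
    [hP : P.IsPrime] (L : Type*) [CommRing L] [IsLocalRing L] [Algebra T L]
    [IsLocalization.AtPrime L P] (𝔟 : Ideal T) (h𝔟 : 𝔟 ≤ P) (p : ℕ) (D : T →+ T)
    (hmul : ∀ x y, D (x * y) = x * D y + y * D x) (hpow : ∀ x, D (x ^ p) ∈ P)
    (hD𝔟 : ∀ x ∈ 𝔟, D x ∈ P) {t : T} (ht : D t ∉ P) (δ : L) :
    algebraMap T L t - δ ^ p ∉ maximalIdeal L ^ 2 ⊔ 𝔟.map (algebraMap T L) := by
  intro hmem
  -- `D` maps `P ^ 2 ⊔ 𝔟` into `P` (Leibniz)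
  have hDsq : ∀ {x}, x ∈ P ^ 2 ⊔ 𝔟 → D x ∈ P := by
    intro x hx
    obtain ⟨y, hy, z, hz, rfl⟩ := Submodule.mem_sup.mp hx
    rw [map_add]
    refine P.add_mem ?_ (hD𝔟 z hz)
    rw [pow_two] at hy
    refine Submodule.mul_induction_on hy (fun b hb c hc => ?_) (fun b c hb hc => ?_)
    · rw [hmul]
      exact P.add_mem (P.mul_mem_right _ hb) (P.mul_mem_right _ hc)
    · rw [map_add]
      exact P.add_mem hb hc
  -- write `δ = f / g` and clear denominators: `m (gᵖ t - fᵖ) ∈ P² + 𝔟` with `m, g ∉ P`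
  obtain ⟨⟨f, g⟩, rfl⟩ := IsLocalization.mk'_surjective P.primeCompl δ
  have key : algebraMap T L ((g : T) ^ p * t - f ^ p) ∈
      maximalIdeal L ^ 2 ⊔ 𝔟.map (algebraMap T L) := by
    have := Ideal.mul_mem_left _ (algebraMap T L (g : T) ^ p) hmem
    convert this using 1
    rw [map_sub, map_mul, map_pow, map_pow, mul_sub, ← mul_pow,
      IsLocalization.mk'_spec' (M := P.primeCompl)]
  rw [← IsLocalization.AtPrime.map_eq_maximalIdeal P L, ← Ideal.map_pow, ← Ideal.map_sup,
    IsLocalization.algebraMap_mem_map_algebraMap_iff P.primeCompl] at key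
  obtain ⟨m, hm, hmy⟩ := key
  set y : T := (g : T) ^ p * t - f ^ p with hy_def
  have hyP : y ∈ P :=
    (hP.mem_or_mem (sup_le (Ideal.pow_le_self two_ne_zero) h𝔟 hmy)).resolve_left hm
  -- apply `D`: `m Dy + y Dm ∈ P`, so `Dy = gᵖ Dt + (t D(gᵖ) - D(fᵖ)) ∈ P`, so `gᵖ Dt ∈ P`
  have hDmy : D (m * y) ∈ P := hDsq hmy
  rw [hmul] at hDmy
  have hmDy : m * D y ∈ P := by
    have := P.sub_mem hDmy (P.mul_mem_right (D m) hyP)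
    rwa [add_sub_cancel_right] at this
  have hDy : D y ∈ P := (hP.mem_or_mem hmDy).resolve_left hm
  have hDy' : D y = (g : T) ^ p * D t + (t * D ((g : T) ^ p) - D (f ^ p)) := by
    rw [hy_def, map_sub, hmul]
    ring
  rw [hDy'] at hDy
  have hgDt : (g : T) ^ p * D t ∈ P := by
    have := P.sub_mem hDy (P.sub_mem (P.mul_mem_left t (hpow g)) (hpow f))
    rwa [add_sub_cancel_right] at this
  exact ht ((hP.mem_or_mem hgDt).resolve_left (Submonoid.pow_mem P.primeCompl g.2 p))

end Derivation

/-! ## Euler's identity for the unit monomial -/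

section Polynomial

/-- If the prime `p` lies in the prime ideal `P`, then an integer prime to `p` does not
(modulo `P` the characteristic is `p`, and `n` is a unit there). [folklore] -/
theorem natCast_notMem_of_not_dvd {T : Type*} [CommRing T] (P : Ideal T) [hP : P.IsPrime]
    {p : ℕ} (hp : p.Prime) (hpP : (p : T) ∈ P) {n : ℕ} (hn : ¬ p ∣ n) : (n : T) ∉ P := by
  intro h
  have h0 : ((p : ℕ) : T ⧸ P) = 0 := by
    rw [← map_natCast (Ideal.Quotient.mk P), Ideal.Quotient.eq_zero_iff_mem]
    exact hpP
  haveI : CharP (T ⧸ P) p := (CharP.charP_iff_prime_eq_zero hp).mpr h0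
  have hu : IsUnit ((n : ℕ) : T ⧸ P) := (CharP.isUnit_natCast_iff hp).mpr hn
  refine hu.ne_zero ?_
  rw [← map_natCast (Ideal.Quotient.mk P), Ideal.Quotient.eq_zero_iff_mem]
  exact h

/-- **Euler for the unit monomial.** Let `P` be a prime of `S₀[T_j : j ∈ σ]` containing none
of the variables, `C s ∉ P`, and `a_{j₀} ∉ P` (as a constant). Then
`∂_{j₀} (s ∏ T_j^{a_j}) ∉ P`: indeed `T_{j₀} · ∂_{j₀} (s ∏ T^a) = a_{j₀} · s ∏ T^a` with all
three factors outside `P`. [folklore] -/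
theorem pderiv_C_mul_prod_X_pow_notMem {S₀ : Type*} [CommRing S₀] {σ : Type*} [Fintype σ]
    (P : Ideal (MvPolynomial σ S₀)) [hP : P.IsPrime]
    (hX : ∀ j, (X j : MvPolynomial σ S₀) ∉ P) {s : S₀} (hs : (C s : MvPolynomial σ S₀) ∉ P)
    (a : σ → ℕ) (j₀ : σ) (ha : ((a j₀ : ℕ) : MvPolynomial σ S₀) ∉ P) :
    pderiv j₀ (C s * ∏ j, X j ^ a j : MvPolynomial σ S₀) ∉ P := by
  classical
  intro hD
  -- the exponent vector as a finitely supported function, and the monomial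
  set m : σ →₀ ℕ := Finsupp.equivFunOnFinite.symm a
  have hw : (∏ j, X j ^ a j : MvPolynomial σ S₀) = monomial m 1 := by
    rw [monomial_eq, C_1, one_mul, Finsupp.prod_fintype _ _ (fun _ => pow_zero _)]
    rfl
  have hwP : (∏ j, X j ^ a j : MvPolynomial σ S₀) ∈ P.primeCompl :=
    Submonoid.prod_mem _ fun j _ => Submonoid.pow_mem _ (hX j) _
  -- Euler: `T_{j₀} · ∂_{j₀} (s w) = a_{j₀} · (s w)`
  have hEuler : X j₀ * pderiv j₀ (C s * ∏ j, X j ^ a j : MvPolynomial σ S₀) =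
      (a j₀ : MvPolynomial σ S₀) * (C s * ∏ j, X j ^ a j) := by
    rw [pderiv_C_mul, mul_left_comm, hw, X_mul_pderiv_monomial, nsmul_eq_mul, mul_left_comm]
    rfl
  have haw : (a j₀ : MvPolynomial σ S₀) * (C s * ∏ j, X j ^ a j) ∈ P := by
    rw [← hEuler]
    exact P.mul_mem_left _ hD
  rcases hP.mem_or_mem haw with h | h
  · exact ha h
  · rcases hP.mem_or_mem h with h | h
    · exact hs h
    · exact hwP h

/-- **A unit monomial with an exponent prime to `p` is not a `p`-th power modulo `𝔪²`.** Let
`L` be the localization of `S₀[T_j : j ∈ σ]` at a prime `𝔔` containing none of the variables,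
with `p ∈ 𝔪_L` (`p` prime), `C s ∉ 𝔔`, and `p ∤ a_{j₀}`. Then
`s ∏ T_j^{a_j} − δ^p ∉ 𝔪_L²` for every `δ ∈ L` (the derivation argument with `D = ∂_{j₀}`,
which kills `p`-th powers modulo `(p) ⊆ 𝔔`). [folklore] -/
theorem C_mul_prod_X_pow_sub_pow_notMem_maximalIdeal_sq {S₀ : Type*} [CommRing S₀]
    {σ : Type*} [Fintype σ] (𝔔 : Ideal (MvPolynomial σ S₀)) [𝔔.IsPrime] (L : Type*)
    [CommRing L] [IsLocalRing L] [Algebra (MvPolynomial σ S₀) L] [IsLocalization.AtPrime L 𝔔]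
    (hX : ∀ j, (X j : MvPolynomial σ S₀) ∉ 𝔔) {p : ℕ} (hp : p.Prime)
    (hpL : (p : L) ∈ maximalIdeal L) {s : S₀} (hs : (C s : MvPolynomial σ S₀) ∉ 𝔔)
    (a : σ → ℕ) {j₀ : σ} (ha : ¬ p ∣ a j₀) (δ : L) :
    algebraMap (MvPolynomial σ S₀) L (C s * ∏ j, X j ^ a j) - δ ^ p ∉ maximalIdeal L ^ 2 := by
  have hpQ : (p : MvPolynomial σ S₀) ∈ 𝔔 := by
    rw [← IsLocalization.AtPrime.to_map_mem_maximal_iff L 𝔔, map_natCast]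
    exact hpL
  have h := sub_pow_notMem_maximalIdeal_sq_sup_of_leibniz 𝔔 L ⊥ bot_le p
    (pderiv j₀ : Derivation S₀ (MvPolynomial σ S₀) (MvPolynomial σ S₀)).toLinearMap.toAddMonoidHom
    (fun x y => ?_) (fun x => ?_) (fun x hx => ?_)
    (t := C s * ∏ j, X j ^ a j) ?_ δ
  · rwa [Ideal.map_bot, sup_bot_eq] at h
  · change pderiv j₀ (x * y) = x * pderiv j₀ y + y * pderiv j₀ x
    rw [Derivation.leibniz, smul_eq_mul, smul_eq_mul]
  · change pderiv j₀ (x ^ p) ∈ 𝔔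
    rw [pderiv_pow, mul_assoc]
    exact 𝔔.mul_mem_right _ hpQ
  · rw [(Submodule.mem_bot _).mp hx, map_zero]
    exact 𝔔.zero_mem
  · exact pderiv_C_mul_prod_X_pow_notMem 𝔔 hX hs a j₀ (natCast_notMem_of_not_dvd 𝔔 hp hpQ ha)

end Polynomial

/-! ## The chart of the blowing up of `(x_1, …, x_r) ⊆ R` at a prime over `𝔭` -/

section Chart

variable {R : Type u} [CommRing R] {r : ℕ} (x : Fin r → R) (i : Fin r)

local notation3 "I" => Ideal.span (Set.range x)
local notation3 "B" => HomogeneousLocalization.Away (reesGrading I)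
  (reesT (x i) (Ideal.mem_span_range_self (f := x) (x := i)))
local notation3 "φ" => reesChartBase (x i) (Ideal.mem_span_range_self (f := x) (x := i))
local notation3 "e[" j "]" =>
  HomogeneousLocalization.Away.mk (reesGrading I)
    (reesT_mem (x i) (Ideal.mem_span_range_self (f := x) (x := i))) 1
    (reesT (x j) (Ideal.mem_span_range_self (f := x) (x := j))) (reesT_mem_one_smul x j)

variable (𝔭 : Ideal R) (Q : Ideal (chartRing x i)) [Q.IsPrime] (S : Type u) [CommRing S]
  [Algebra (chartRing x i) S] [IsLocalization.AtPrime S Q] [IsLocalRing S]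

/-- The structure map `B → S` (type-ascribed, which keeps instance search from stalling on the
chart ring). -/
local notation3 "aS" => (algebraMap B S : B →+* S)

/-- **The REG clause on a blow-up chart, boundary equations as an ideal.** Let `x` be
quasi-regular in `R`, `B = (R[It])_{(x_i t)}` the chart, `Q ⊂ B` a prime containing `φ(x_i)`
and lying over `𝔭` (`φ s ∈ Q ↔ s ∈ 𝔭`), `S = B_Q`, `K ⊆ 𝔭`. If all `e_j ∉ Q` (`j ≠ i`),
`s ∉ 𝔭`, `p ∈ 𝔪_S` is prime and `p ∤ a_{j₀}` for some `j₀ ≠ i`, then for every `δ ∈ S`,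
`s ∏_j e_j^{a_j} − δ^p ∉ 𝔪_S² + J(K, ∅) S`, `J(K, ∅) = (φ x_i) + K B` the stage ideal
(`chartStageIdeal`; `e_i = 1`). [folklore] -/
theorem reesChart_unit_mul_prod_chartGen_pow_sub_pow_notMem (hx : IsQuasiRegular x)
    (K : Ideal R) (hxi : φ (x i) ∈ Q) (hQ : ∀ s : R, φ s ∈ Q ↔ s ∈ 𝔭) (hK : K ≤ 𝔭)
    (he : ∀ j, j ≠ i → e[j] ∉ Q) {p : ℕ} (hp : p.Prime) (hpS : (p : S) ∈ maximalIdeal S)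
    {s : R} (hs : s ∉ 𝔭) (a : Fin r → ℕ) {j₀ : Fin r} (hj₀ : j₀ ≠ i) (ha : ¬ p ∣ a j₀) (δ : S) :
    aS (φ s) * ∏ j, aS e[j] ^ a j - δ ^ p ∉
      maximalIdeal S ^ 2 ⊔ (chartStageIdeal x i K ∅).map aS := by
  classical
  -- name the structure map and the stage ideal once (instance search on `B` is expensive)
  set ψ : B →+* S := aS
  set J : Ideal S := (chartStageIdeal x i K ∅).map ψ
  have hi : i ∉ (∅ : Set (Fin r)) := Set.notMem_empty i
  have hJQ : chartStageIdeal x i K ∅ ≤ Q :=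
    chartStageIdeal_le x i K ∅ 𝔭 Q (fun j hj => absurd hj (Set.notMem_empty j)) hxi hQ hK
  -- `S/J` is the localization of `(R/(I + K))[T_j : j ≠ i]` at `𝔔₀(Q)`
  haveI h𝔔 := chartStagePrime_isPrime x i K ∅ hx hi Q hJQ
  letI algT : Algebra (MvPolynomial {j : Fin r // j ≠ i ∧ j ∉ (∅ : Set (Fin r))} (R ⧸ (I ⊔ K)))
      (S ⧸ J) := chartStageAlgebra x i K ∅ hx hi S
  haveI hloc : IsLocalization.AtPrime (S ⧸ J) (chartStagePrime x i K ∅ hx hi Q) :=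
    isLocalization_atPrime_chartStage x i K ∅ hx hi Q S hJQ
  haveI : IsLocalRing (S ⧸ J) :=
    IsLocalization.AtPrime.isLocalRing (S ⧸ J) (chartStagePrime x i K ∅ hx hi Q)
  -- the quotient map and the maximal ideals
  have hmax : (maximalIdeal S).map (Ideal.Quotient.mk J) = maximalIdeal (S ⧸ J) :=
    IsLocalRing.map_maximalIdeal_of_surjective _ Ideal.Quotient.mk_surjective
  have hpS' : (p : S ⧸ J) ∈ maximalIdeal (S ⧸ J) := by
    rw [← hmax, ← map_natCast (Ideal.Quotient.mk J) p]
    exact Ideal.mem_map_of_mem _ hpS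
  -- the element is the image of the unit monomial `s̄ ∏ T_j^{a_j}`
  have helem : Ideal.Quotient.mk J (ψ (φ s) * ∏ j, ψ e[j] ^ a j) =
      algebraMap (MvPolynomial {j : Fin r // j ≠ i ∧ j ∉ (∅ : Set (Fin r))} (R ⧸ (I ⊔ K)))
        (S ⧸ J) (C (Ideal.Quotient.mk (I ⊔ K) s) *
          ∏ j : {j : Fin r // j ≠ i ∧ j ∉ (∅ : Set (Fin r))}, X j ^ a j.1) := by
    simp only [map_mul, map_prod, map_pow]
    rw [← chartStageAlgebra_algebraMap_C x i K ∅ hx hi S s]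
    refine congrArg₂ (· * ·) rfl ?_
    -- drop the factor `e_i = 1` and reindex by `{j // j ≠ i}`
    rw [← Finset.mul_prod_erase Finset.univ _ (Finset.mem_univ i), chartGen_self x i, map_one,
      map_one, one_pow, one_mul]
    have h2 : ∏ j ∈ Finset.univ.erase i, Ideal.Quotient.mk J (ψ e[j]) ^ a j =
        ∏ j : {j : Fin r // j ≠ i ∧ j ∉ (∅ : Set (Fin r))},
          Ideal.Quotient.mk J (ψ e[j.1]) ^ a j.1 :=
      Finset.prod_subtype _ (fun j => by simp [Finset.mem_erase]) _
    rw [h2]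
    refine Fintype.prod_congr _ _ fun j => ?_
    rw [← chartStageAlgebra_algebraMap_X x i K ∅ hx hi S j]
  -- no variable lies in `𝔔₀(Q)`, nor does the constant `s̄`
  have hX : ∀ j : {j : Fin r // j ≠ i ∧ j ∉ (∅ : Set (Fin r))},
      (X j : MvPolynomial _ (R ⧸ (I ⊔ K))) ∉ chartStagePrime x i K ∅ hx hi Q := fun j hj =>
    he j.1 j.2.1 ((X_mem_chartStagePrime_iff x i K ∅ hx hi hJQ j).mp hj)
  have hsQ : (C (Ideal.Quotient.mk (I ⊔ K) s) : MvPolynomial _ (R ⧸ (I ⊔ K))) ∉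
      chartStagePrime x i K ∅ hx hi Q := fun h =>
    hs ((hQ s).mp ((C_mem_chartStagePrime_iff x i K ∅ hx hi hJQ s).mp h))
  -- pass to `S/J`
  intro hmem
  obtain ⟨y, hy, z, hz, hyz⟩ := Submodule.mem_sup.mp hmem
  have hy' := Ideal.mem_map_of_mem (Ideal.Quotient.mk J) hy
  rw [Ideal.map_pow, hmax] at hy'
  have h3 := congrArg (Ideal.Quotient.mk J) hyz
  rw [map_add, Ideal.Quotient.eq_zero_iff_mem.mpr hz, add_zero, map_sub, map_pow, helem] at h3
  rw [h3] at hy'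
  exact C_mul_prod_X_pow_sub_pow_notMem_maximalIdeal_sq (chartStagePrime x i K ∅ hx hi Q) (S ⧸ J)
    hX hp hpS' hsQ (fun j : {j : Fin r // j ≠ i ∧ j ∉ (∅ : Set (Fin r))} => a j.1)
    (j₀ := ⟨j₀, hj₀, Set.notMem_empty j₀⟩) ha _ hy'

/-- **The REG clause on a blow-up chart, boundary coordinates.** Same setting, with the
boundary given by elements `w_m ∈ 𝔭`, `m ∈ Lab`: for every `δ ∈ S`,
`s ∏_j e_j^{a_j} − δ^p ∉ 𝔪_S² + (φ x_i, (φ w_m)_{m ∈ Lab}) S`. This is the transversality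
("REG") clause for the unit radicand at the points of the blow-up over the centre at which no
new coordinate is charged (setting of `exists_rsop_chart`, fed by `BlowupSNC.ChartData`).
[folklore] -/
theorem reesChart_unit_mul_prod_chartGen_pow_sub_pow_notMem_span (hx : IsQuasiRegular x)
    (hxi : φ (x i) ∈ Q) (hQ : ∀ s : R, φ s ∈ Q ↔ s ∈ 𝔭) {l : ℕ} (w : Fin l → R)
    (Lab : Set (Fin l)) (hw : ∀ m ∈ Lab, w m ∈ 𝔭) (he : ∀ j, j ≠ i → e[j] ∉ Q)
    {p : ℕ} (hp : p.Prime) (hpS : (p : S) ∈ maximalIdeal S) {s : R} (hs : s ∉ 𝔭)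
    (a : Fin r → ℕ) {j₀ : Fin r} (hj₀ : j₀ ≠ i) (ha : ¬ p ∣ a j₀) (δ : S) :
    aS (φ s) * ∏ j, aS e[j] ^ a j - δ ^ p ∉
      maximalIdeal S ^ 2 ⊔ Ideal.span (insert (aS (φ (x i))) ((fun m => aS (φ (w m))) '' Lab)) := by
  set ψ : B →+* S := aS
  have hK : Ideal.span (w '' Lab) ≤ 𝔭 := by
    rw [Ideal.span_le]
    rintro _ ⟨m, hm, rfl⟩
    exact hw m hm
  have h := reesChart_unit_mul_prod_chartGen_pow_sub_pow_notMem x i 𝔭 Q S hx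
    (Ideal.span (w '' Lab)) hxi hQ hK he hp hpS hs a hj₀ ha δ
  have hJ : (chartStageIdeal x i (Ideal.span (w '' Lab)) ∅).map ψ =
      Ideal.span (insert (ψ (φ (x i))) ((fun m => ψ (φ (w m))) '' Lab)) := by
    rw [chartStageIdeal, Set.image_empty, Ideal.span_empty, sup_bot_eq, Ideal.map_sup,
      Ideal.map_map, Ideal.map_span, Set.image_singleton, Ideal.map_span, Ideal.span_insert,
      Set.image_image]
    rfl
  rwa [hJ] at h

/-- **The REG clause on a blow-up chart, unit factor from the local ring downstairs.** Same
setting, with `A = R_𝔭` (`𝔭` prime) mapping to `S` compatibly with `φ` (`ψ_A (t/1) = φ(t)/1`;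
e.g. the stalk map `𝒪_{X,π x'} → 𝒪_{X',x'}`) and the unit factor `u ∈ Aˣ`: for every `δ ∈ S`,
`ψ_A(u) ∏_j e_j^{a_j} − δ^p ∉ 𝔪_S² + (φ x_i, (φ w_m)_{m ∈ Lab}) S` (write `u = s/s'` and
multiply by the unit `φ(s')^p`). [folklore] -/
theorem reesChart_unit_mul_prod_chartGen_pow_sub_pow_notMem_span_of_isUnit [𝔭.IsPrime]
    {A : Type*} [CommRing A] [Algebra R A] [IsLocalization.AtPrime A 𝔭] (ψA : A →+* S)
    (hψ : ∀ t : R, ψA (algebraMap R A t) = aS (φ t)) (hx : IsQuasiRegular x)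
    (hxi : φ (x i) ∈ Q) (hQ : ∀ s : R, φ s ∈ Q ↔ s ∈ 𝔭) {l : ℕ} (w : Fin l → R)
    (Lab : Set (Fin l)) (hw : ∀ m ∈ Lab, w m ∈ 𝔭) (he : ∀ j, j ≠ i → e[j] ∉ Q)
    {p : ℕ} (hp : p.Prime) (hpS : (p : S) ∈ maximalIdeal S) {u : A} (hu : IsUnit u)
    (a : Fin r → ℕ) {j₀ : Fin r} (hj₀ : j₀ ≠ i) (ha : ¬ p ∣ a j₀) (δ : S) :
    ψA u * ∏ j, aS e[j] ^ a j - δ ^ p ∉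
      maximalIdeal S ^ 2 ⊔ Ideal.span (insert (aS (φ (x i))) ((fun m => aS (φ (w m))) '' Lab)) := by
  set ψ : B →+* S := aS
  -- `u = s / s'` with `s, s' ∉ 𝔭`, and `p = k + 1`
  obtain ⟨⟨s, s'⟩, rfl⟩ := IsLocalization.mk'_surjective 𝔭.primeCompl u
  obtain ⟨k, hk⟩ : ∃ k, p = k + 1 := ⟨p - 1, (Nat.sub_add_cancel hp.one_le).symm⟩
  have hs : s ∉ 𝔭 := (IsLocalization.AtPrime.isUnit_mk'_iff A 𝔭 s s').mp hu
  have hss' : (s' : R) ^ k * s ∉ 𝔭 := fun h =>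
    (‹𝔭.IsPrime›.mem_or_mem h).elim (fun h' => s'.2 (‹𝔭.IsPrime›.mem_of_pow_mem _ h')) hs
  have h1 : ψ (φ s') * ψA (IsLocalization.mk' A s s') = ψ (φ s) := by
    rw [← hψ, ← hψ, ← map_mul, IsLocalization.mk'_spec'_mk]
  -- multiply by the unit `φ(s')^p`
  have hid : ψ (φ s') ^ p * (ψA (IsLocalization.mk' A s s') * ∏ j, ψ e[j] ^ a j - δ ^ p) =
      ψ (φ ((s' : R) ^ k * s)) * ∏ j, ψ e[j] ^ a j - (ψ (φ s') * δ) ^ p := by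
    rw [hk, pow_succ, map_mul, map_mul, map_pow, map_pow, mul_pow, ← h1]
    ring
  intro hmem
  have hmem' := Ideal.mul_mem_left _ (ψ (φ s') ^ p) hmem
  rw [hid] at hmem'
  exact reesChart_unit_mul_prod_chartGen_pow_sub_pow_notMem_span x i 𝔭 Q S hx hxi hQ w Lab hw he
    hp hpS hss' a hj₀ ha (ψ (φ s') * δ) hmem'

end Chart

/-! ## The chart of a regular local ring along part of a regular system of parameters -/

section RegularLocal

variable {R : Type u} [CommRing R] [IsRegularLocalRing R] {n l : ℕ} (c : Fin n → R) (i : Fin n)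
  (w : Fin l → R) (hz : Ideal.span (Set.range (Fin.append c w)) = maximalIdeal R)
  (hd : (maximalIdeal R).spanFinrank = n + l)
  (𝔓 : Ideal (chartRing c i)) [𝔓.IsPrime] (h𝔓 : 𝔓.comap (chartBase c i) = maximalIdeal R)
  (L : Type u) [CommRing L] [IsLocalRing L] [Algebra (chartRing c i) L]
  [IsLocalization.AtPrime L 𝔓]

/-- The structure map `B → L` (type-ascribed). -/
local notation3 "aL" => (algebraMap (chartRing c i) L : chartRing c i →+* L)

include hz hd h𝔓 in
/-- **The REG clause on the chart `D₊(cᵢ t)` of `Bl_{(c)} Spec R`**, `R` regular local with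
regular system of parameters `(c, w)` (setting of `isRsopPart_chartFamily_reesChart`): at a
prime `𝔓` of `chartRing c i` over `𝔪_R` at which all chart generators `e_j`, `j ≠ i`, are
units, for `s ∈ Rˣ`, boundary labels `Lab`, exponents `a` with `p ∤ a_{j₀}` for some
`j₀ ≠ i`, and `p ∈ 𝔪_L` prime (`L` any localization of the chart at `𝔓`): for every `δ ∈ L`,
`s ∏_j e_j^{a_j} − δ^p ∉ 𝔪_L² + (cᵢ, (w_m)_{m ∈ Lab}) L`. [folklore] -/
theorem unit_mul_prod_chartGen_pow_sub_pow_notMem_span (he : ∀ j, j ≠ i → chartGen c i j ∉ 𝔓)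
    {p : ℕ} (hp : p.Prime) (hpL : (p : L) ∈ maximalIdeal L) {s : R} (hs : IsUnit s)
    (Lab : Set (Fin l)) (a : Fin n → ℕ) {j₀ : Fin n} (hj₀ : j₀ ≠ i) (ha : ¬ p ∣ a j₀) (δ : L) :
    aL (chartBase c i s) * ∏ j, aL (chartGen c i j) ^ a j - δ ^ p ∉
      maximalIdeal L ^ 2 ⊔
        Ideal.span (insert (aL (chartBase c i (c i))) ((fun m => aL (chartBase c i (w m))) '' Lab)) := by
  have hQ : ∀ t : R, chartBase c i t ∈ 𝔓 ↔ t ∈ maximalIdeal R := fun t => by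
    rw [← Ideal.mem_comap, h𝔓]
  have hw : ∀ m ∈ Lab, w m ∈ maximalIdeal R := fun m _ =>
    hz ▸ Ideal.subset_span ⟨Fin.natAdd n m, by simp⟩
  have hs' : s ∉ maximalIdeal R := fun h =>
    (mem_nonunits_iff.mp ((IsLocalRing.mem_maximalIdeal s).mp h)) hs
  exact reesChart_unit_mul_prod_chartGen_pow_sub_pow_notMem_span c i (maximalIdeal R) 𝔓 L
    (isQuasiRegular_centre c w hz hd) (map_centre_mem c w hz (chartBase c i) 𝔓 h𝔓 i) hQ w Lab hw
    he hp hpL hs' a hj₀ ha δ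

end RegularLocal

end Literature.AlgebraicGeometry.Resolution

end
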